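import Summits.BirchSwinnertonDyer.BirchSwinnertonDyer.Theorems.RamifiedSevenEllipticUnitsLemmaXi
import Summits.BirchSwinnertonDyer.BirchSwinnertonDyer.Theorems.RamifiedSevenEllipticUnitsRelativeValuationOfDatumPinned
import HarnessLib

set_option linter.dupNamespace false
set_option autoImplicit false

/-!
# Clause (P3) of the Rubin package: ramification of the interpolated character `φ^{2k+1}`

Helper file for the K7r Value crux `EllipticUnitValueSevenOfGZK` (stmt-BirchSwinnertonDyer-19945), line
`rubin-formula-zp` v4, stub `stub_rubinPackageSevenZp`, clause (P3): the interpolated character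
`φ^{k+1} (φ∘c)^k ξ₁^k · 𝟙` — which is `φ^{2k+1}` once (P1) `ξ₁ = φ(φ∘c)⁻¹` holds
(`RelativeValuationOfDatum.interpolatedCharacter_eq_pow`, LEMMA Ξ of `…LemmaXi`) — is ramified at `𝔭`
and at every place where `φ` is ramified. For the Grössencharacter `ψ` of a CM curve `E/ℚ` with
`𝒪_K^× = {±1}` the local characters `ψ|_{𝒪_w^×}` are quadratic (Silverman ATAEC II Thm. 9.2:
`ψ(x) = ε(x) x_∞⁻¹` on `U_𝔣`, `ε` with values in `𝒪_K^×`), so `ψ²` is unramified at every finite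
place; this file proves the elementary consequence: if `φ²` is unramified at `w` and `φ` is not, then
no odd power `φ^{2k+1}` is unramified at `w` (`not_isUnramifiedAt_pow_odd`), and packages it in the
shape of (P3) (`package_P3_of_sq_unramified`).

References: Silverman, *Advanced Topics*, II Thm. 9.2; [BKNO] arXiv:2608.06879 §4.1 ("`𝔭` may exactly
divide `𝔣`", `L_{pf}`).
-/

noncomputable section

open NumberField IsDedekindDomain
  Literature.NumberTheory.GaloisRepresentations

namespace Summit.BirchSwinnertonDyer.BirchSwinnertonDyer.Theorems.RamifiedSevenEllipticUnits

namespace LemmaXi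

variable {K : Type} [Field K] [NumberField K]

/-- **Odd powers of a character with quadratic local component stay ramified**: if `φ²` is unramified
at `w` but `φ` is not, then `φ^{2k+1}` is ramified at `w` (`φ = φ^{2k+1} · ((φ²)^k)⁻¹`).
[cite: SilvermanATAEC1994, Ch. II Thm. 9.2 (the local characters ε of ψ_{E/L})] -/
theorem not_isUnramifiedAt_pow_odd {φ : HeckeCharacter K} {w : HeightOneSpectrum (𝓞 K)}
    (h2 : (φ ^ 2).IsUnramifiedAt w) (hφ : ¬ φ.IsUnramifiedAt w) (k : ℕ) :
    ¬ (φ ^ (2 * k + 1)).IsUnramifiedAt w := by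
  intro h
  apply hφ
  have hk : ((φ ^ 2) ^ k)⁻¹.IsUnramifiedAt w := by
    have := h2.zpow' (k : ℤ)
    rw [zpow_natCast] at this
    exact this.inv'
  have heq : φ ^ (2 * k + 1) * ((φ ^ 2) ^ k)⁻¹ = φ := by
    rw [← pow_mul, pow_succ, mul_inv_cancel_comm]
  rw [← heq]
  exact h.mul' hk

/-- **Clause (P3) from "`φ²` unramified everywhere, `φ` ramified at `𝔭`"**: for every `w` with
`w = 𝔭 ∨ φ` ramified at `w`, the odd power `φ^{2k+1}` is ramified at `w`.
[cite: BurungaleKobayashiNakamuraOta2026, §4.1 (arXiv:2608.06879 p. 25) (the primes dividing pf; shape only)]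
[cite: SilvermanATAEC1994, Ch. II Thm. 9.2] -/
theorem package_P3_of_sq_unramified {φ : HeckeCharacter K} {𝔭 : HeightOneSpectrum (𝓞 K)}
    (h2 : ∀ w : HeightOneSpectrum (𝓞 K), (φ ^ 2).IsUnramifiedAt w) (h𝔭 : ¬ φ.IsUnramifiedAt 𝔭)
    (k : ℕ) (w : HeightOneSpectrum (𝓞 K)) (hw : w = 𝔭 ∨ ¬ φ.IsUnramifiedAt w) :
    ¬ (φ ^ (2 * k + 1)).IsUnramifiedAt w := by
  rcases hw with rfl | hw
  · exact not_isUnramifiedAt_pow_odd (h2 _) h𝔭 k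
  · exact not_isUnramifiedAt_pow_odd (h2 w) hw k

/-- **Clause (P3) in the package's literal shape**, granted (P1) `ξ₁ = φ(φ∘c)⁻¹` (LEMMA Ξ): for every
`w` with `w = 𝔭 ∨ φ` ramified at `w`, the interpolated character `φ^{k+1} (φ∘c)^k ξ₁^k · 𝟙 = φ^{2k+1}`
(`RelativeValuationOfDatum.interpolatedCharacter_eq_pow`) is ramified at `w` — from "`φ²` unramified at
every finite place" and "`φ` ramified at `𝔭`".
[cite: BurungaleKobayashiNakamuraOta2026, §4.1 and Def. 4.2 (arXiv:2608.06879 pp. 24–25) (shape only)]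
[cite: SilvermanATAEC1994, Ch. II Thm. 9.2] -/
theorem package_P3_of_xi_eq {φ ξ₁ : HeckeCharacter K} {c : K ≃ₐ[ℚ] K} {𝔭 : HeightOneSpectrum (𝓞 K)}
    (hξ : ξ₁ = φ * (HeckeCharacter.galConj c φ)⁻¹)
    (h2 : ∀ w : HeightOneSpectrum (𝓞 K), (φ ^ 2).IsUnramifiedAt w) (h𝔭 : ¬ φ.IsUnramifiedAt 𝔭)
    (k : ℕ) (w : HeightOneSpectrum (𝓞 K)) (hw : w = 𝔭 ∨ ¬ φ.IsUnramifiedAt w) :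
    ¬ (φ ^ (k + 1) * HeckeCharacter.galConj c φ ^ k * ξ₁ ^ k * 1).IsUnramifiedAt w := by
  rw [RelativeValuationOfDatum.interpolatedCharacter_eq_pow hξ k]
  exact package_P3_of_sq_unramified h2 h𝔭 k w hw

end LemmaXi

end Summit.BirchSwinnertonDyer.BirchSwinnertonDyer.Theorems.RamifiedSevenEllipticUnits

end
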